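import Mathlib.Data.ZMod.Basic
import Mathlib.Tactic.LinearCombination
import Mathlib.Tactic.Ring
import HarnessLib

/-!
# Two halves over cyclic fibres: an aperiodic `θ`-asymmetric CM half of `B × ℤ/n` for every `n ≥ 3`

COR-CM (cell `pub-hodgecm2`), binder seat b04 (gen 29), count-neutral own lane «Galois-CM-type classification» (which Galois CM
fields `(G, c)` have ALL primitive CM types nondegenerate = GOOD, vs. a primitive degenerate type = BAD).  KERNEL ONLY: theorems,
Mathlib only; no definition, no named fact, no `sorry`.  `HC_CM` is neither used nor claimed.

PURPOSE.  The doubled-type theorems of this lane (`CorCM/GaloisSplitInvolutionTypes`, `CorCM/GaloisIndexTwoDoubledTypes` and their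
instances `D₄ × C_n`, `D₈/SD₁₆/M₁₆ × C_n`, Pauli `× C_n`, `(C₄×C₂)⋊C₂ × C_n`, `(C₄⋊C₄) × C_n`) need, for `A = B × ℤ/n` (`B` a finite
abelian group carrying `c` and the automorphism `θ`, extended trivially to `ℤ/n`), a CM half `S ⊂ A` which is APERIODIC (`a + S ≠ S`
for `a ≠ 0`) and `θ`-ASYMMETRIC (`a + θ(S) ≠ S` for all `a`).  THE FIBRE CONSTRUCTION: from two CM halves `H₁ ≠ H₂` of `(B, c)` put
`S = {(b, v) : b ∈ H₁ (v ≠ 1), b ∈ H₂ (v = 1)}`, i.e. the predicate `P(b, v) = if v = 1 then b ∈ H₂ else b ∈ H₁`.  Then for `n ≥ 3`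
(three distinct fibres `v = 0, 1, 2`):
* `fibre_cm`: `S` is a CM half for `(c, 0)`;
* `fibre_aperiodic`: `S` is aperiodic as soon as NO `a ≠ 0` of `B` stabilises BOTH `H₁` and `H₂` — a period `(a₁, a₃)` with `a₃ ≠ 0`
  compares a generic fibre (`H₁ + a₁ = H₁`) with the fibre `v = 1 − a₃` (`H₁ + a₁ = H₂`), forcing `H₁ = H₂`; with `a₃ = 0` it stabilises both;
* `fibre_asymmetric`: `S` is `θ`-asymmetric (`θ` surjective) as soon as NO `a` of `B` has BOTH `a + θ(H₁) = H₁` and `a + θ(H₂) = H₂` —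
  same comparison.
All three hypotheses on `(H₁, H₂)` are finite statements inside `B`, checked by `decide` per group; so **ONE pair of halves of `B` makes
`Γ × C_n` BAD for EVERY `n ≥ 3` at once** (the instances so far were `n = 3, 5` by `decide` on the whole of `B × ℤ/n`, or hand-made
symbolic arguments for `ℤ/4`, `ℤ/8`).

## References

* [Kubota1965] T. Kubota, *On the field extension by complex multiplication*, Trans. AMS 118 (1965), §2 (CM types as halves).
* [Shimura1998] G. Shimura, *Abelian Varieties with Complex Multiplication and Modular Functions*, §8.2 (Galois action on types).
-/

namespace Summit.HodgeConjecture.CorCM.TwoHalves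

variable {B : Type*} [AddCommGroup B] {n : ℕ}

/-- **CM**: the fibred set of two CM halves is a CM half for `(c, 0)`. [folklore] -/
theorem fibre_cm (H₁ H₂ : Finset B) (c : B) (h₁ : ∀ b, b ∈ H₁ ↔ c + b ∉ H₁) (h₂ : ∀ b, b ∈ H₂ ↔ c + b ∉ H₂) (s : B × ZMod n) :
    (if s.2 = 1 then s.1 ∈ H₂ else s.1 ∈ H₁) ↔
      ¬ (if ((c, (0 : ZMod n)) + s).2 = 1 then ((c, (0 : ZMod n)) + s).1 ∈ H₂ else ((c, (0 : ZMod n)) + s).1 ∈ H₁) := by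
  obtain ⟨b, v⟩ := s
  simp only [Prod.mk_add_mk, zero_add]
  split_ifs
  · exact h₂ b
  · exact h₁ b

/-- Three distinct fibres: for `n ≥ 3` there is `v₀` with `v₀ ≠ 1` and `a₃ + v₀ ≠ 1`. [folklore] -/
theorem exists_generic_fibre (hn : 3 ≤ n) (a₃ : ZMod n) : ∃ v₀ : ZMod n, v₀ ≠ 1 ∧ a₃ + v₀ ≠ 1 := by
  haveI : Fact (1 < n) := ⟨by omega⟩
  have h01 : (0 : ZMod n) ≠ 1 := zero_ne_one
  have h20 : (2 : ZMod n) ≠ 0 := by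
    intro h
    have : ((2 : ℕ) : ZMod n) = 0 := by exact_mod_cast h
    rw [ZMod.natCast_eq_zero_iff] at this
    exact absurd (Nat.le_of_dvd (by norm_num) this) (by omega)
  have h21 : (2 : ZMod n) ≠ 1 := fun h => one_ne_zero (by linear_combination h : (1 : ZMod n) = 0)
  by_cases h : a₃ = 1
  · exact ⟨2, h21, by rw [h]; exact fun h' => h20 (by linear_combination h')⟩
  · exact ⟨0, h01, by rwa [add_zero]⟩

/-- **APERIODIC**: if no `a ≠ 0` of `B` stabilises both `H₁` and `H₂ ≠ H₁`, the fibred set has no period in `B × ℤ/n`, `n ≥ 3`.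
[folklore] -/
theorem fibre_aperiodic (hn : 3 ≤ n) (H₁ H₂ : Finset B) (hne : H₁ ≠ H₂)
    (hstab : ∀ a : B, a ≠ 0 → (∃ b, ¬ (b ∈ H₁ ↔ a + b ∈ H₁)) ∨ (∃ b, ¬ (b ∈ H₂ ↔ a + b ∈ H₂)))
    (a : B × ZMod n) (ha : a ≠ 0) :
    ∃ s : B × ZMod n, ¬ ((if s.2 = 1 then s.1 ∈ H₂ else s.1 ∈ H₁) ↔
      (if (a + s).2 = 1 then (a + s).1 ∈ H₂ else (a + s).1 ∈ H₁)) := by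
  haveI : Fact (1 < n) := ⟨by omega⟩
  have h01 : (0 : ZMod n) ≠ 1 := zero_ne_one
  obtain ⟨a₁, a₃⟩ := a
  by_contra hcon
  push Not at hcon
  have hfib : ∀ (b : B) (v : ZMod n),
      (if v = 1 then b ∈ H₂ else b ∈ H₁) ↔ (if a₃ + v = 1 then a₁ + b ∈ H₂ else a₁ + b ∈ H₁) := fun b v => by
    simpa only [Prod.mk_add_mk] using hcon (b, v)
  by_cases ha₃ : a₃ = 0
  · subst ha₃
    have ha₁ : a₁ ≠ 0 := fun h => ha (by rw [h]; rfl)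
    rcases hstab a₁ ha₁ with ⟨b, hb⟩ | ⟨b, hb⟩
    · apply hb
      have h := hfib b 0
      rwa [zero_add, if_neg h01, if_neg h01] at h
    · apply hb
      have h := hfib b 1
      rwa [zero_add, if_pos rfl, if_pos rfl] at h
  · obtain ⟨v₀, hv₀, hv₀'⟩ := exists_generic_fibre hn a₃
    have h1a : (1 : ZMod n) - a₃ ≠ 1 := fun h => ha₃ (by simpa using h)
    have hsum : a₃ + (1 - a₃) = 1 := by ring
    have hper : ∀ b, b ∈ H₁ ↔ a₁ + b ∈ H₁ := fun b => by
      have h := hfib b v₀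
      rwa [if_neg hv₀, if_neg hv₀'] at h
    have hmix : ∀ b, b ∈ H₁ ↔ a₁ + b ∈ H₂ := fun b => by
      have h := hfib b (1 - a₃)
      rwa [if_neg h1a, hsum, if_pos rfl] at h
    apply hne
    ext y
    have e1 := hper (y - a₁)
    have e2 := hmix (y - a₁)
    rw [add_sub_cancel] at e1 e2
    exact e1.symm.trans e2

/-- **`θ`-ASYMMETRIC**: if no `a` of `B` has both `a + θ(H₁) = H₁` and `a + θ(H₂) = H₂` (`θ` surjective, `H₁ ≠ H₂`), the fibred set
satisfies `a + (θ × id)(S) ≠ S` for every `a ∈ B × ℤ/n`, `n ≥ 3`. [folklore] -/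
theorem fibre_asymmetric (hn : 3 ≤ n) (θ : B → B) (hθ : Function.Surjective θ) (H₁ H₂ : Finset B) (hne : H₁ ≠ H₂)
    (hR : ∀ a : B, (∃ b, ¬ (b ∈ H₁ ↔ a + θ b ∈ H₁)) ∨ (∃ b, ¬ (b ∈ H₂ ↔ a + θ b ∈ H₂))) (a : B × ZMod n) :
    ∃ s : B × ZMod n, ¬ ((if s.2 = 1 then s.1 ∈ H₂ else s.1 ∈ H₁) ↔
      (if (a + (θ s.1, s.2)).2 = 1 then (a + (θ s.1, s.2)).1 ∈ H₂ else (a + (θ s.1, s.2)).1 ∈ H₁)) := by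
  haveI : Fact (1 < n) := ⟨by omega⟩
  have h01 : (0 : ZMod n) ≠ 1 := zero_ne_one
  obtain ⟨a₁, a₃⟩ := a
  by_contra hcon
  push Not at hcon
  have hfib : ∀ (b : B) (v : ZMod n),
      (if v = 1 then b ∈ H₂ else b ∈ H₁) ↔ (if a₃ + v = 1 then a₁ + θ b ∈ H₂ else a₁ + θ b ∈ H₁) := fun b v => by
    simpa only [Prod.mk_add_mk] using hcon (b, v)
  by_cases ha₃ : a₃ = 0
  · subst ha₃
    rcases hR a₁ with ⟨b, hb⟩ | ⟨b, hb⟩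
    · apply hb
      have h := hfib b 0
      rwa [zero_add, if_neg h01, if_neg h01] at h
    · apply hb
      have h := hfib b 1
      rwa [zero_add, if_pos rfl, if_pos rfl] at h
  · obtain ⟨v₀, hv₀, hv₀'⟩ := exists_generic_fibre hn a₃
    have h1a : (1 : ZMod n) - a₃ ≠ 1 := fun h => ha₃ (by simpa using h)
    have hsum : a₃ + (1 - a₃) = 1 := by ring
    have hper : ∀ b, b ∈ H₁ ↔ a₁ + θ b ∈ H₁ := fun b => by
      have h := hfib b v₀
      rwa [if_neg hv₀, if_neg hv₀'] at h
    have hmix : ∀ b, b ∈ H₁ ↔ a₁ + θ b ∈ H₂ := fun b => by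
      have h := hfib b (1 - a₃)
      rwa [if_neg h1a, hsum, if_pos rfl] at h
    apply hne
    ext y
    obtain ⟨b, hb⟩ := hθ (y - a₁)
    have e1 := hper b
    have e2 := hmix b
    rw [hb, add_sub_cancel] at e1 e2
    exact e1.symm.trans e2

end Summit.HodgeConjecture.CorCM.TwoHalves
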